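import Literature.Analysis.FluidPDE.ShearCascadeInviscid
import Literature.Analysis.FluidPDE.ShearCascadeProfiles
import Literature.Analysis.FluidPDE.ShearStageTransport
import Literature.Analysis.FluidPDE.CheskidovTotalDissipation
import Mathlib.Analysis.SpecialFunctions.SmoothTransition
import HarnessLib

/-!
# The shear cascade: time grid, amplitudes, drifts and their Navier–Stokes forces

Analysis/FluidPDE support file (everything proved; no named facts). Third part of the
alternating near-triangle shear cascade (`TorusShearKoopman`, `ShearCascadeProfiles`,
`ShearCascadeInviscid`, `ShearStageTransport`), on the way to an explicit family of smooth
drifts with *partial* anomalous dissipation feeding the periodisation of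
`CheskidovPartialPeriodisation` (A. Cheskidov, arXiv:2311.04182, Theorem 1.3, with §4's
building block replaced by an explicit shear cascade). This file fixes all the *time* data of the
cascade and builds the drifts `vel m` together with the bookkeeping of their Navier–Stokes forces:

* the concrete profile family `cascadePF` (near-triangles `nearTri (2^{-(s+5)})`, residues
  `2^{-(s+4)}`), derivative bounds `L1 s`, `L2 s` of its profiles and `Cψ1`, `Cψ2` of
  `Real.smoothTransition`;
* the time grid: slot starts `σ s = 1 - 2^{-s}`, viscosity scales `μ s = 64 (s+1) 2^s`,
  frequency-free gradient-growth constants `Λ s`, active lengths `T s ≤ 2^{-(s+2)}` with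
  `T_s (s+1)² μ_s Λ_s² ≤ 1` (`T_mul_le`), idle gaps `P s ≥ 2^{-(s+2)}` (`P_ge`), and
  `σ (s+1) = σ s + T s + P s` (`σ_succ`);
* the amplitudes `amp s t = smoothTransition ((t - σ_s)/T_s)` with flatness off the slot
  (`amp_of_le`, `amp_of_ge`, `deriv_amp_eq_zero`, `deriv_deriv_amp_eq_zero`), the bounds
  `|amp'| ≤ Cψ1/T_s`, `|amp''| ≤ Cψ2/T_s²`, and the active stage `act t` (`slot_unique`);
* the external constraint `extra` closing the frequency recursion of `ShearCascadeInviscid`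
  (energy, force and viscous scales of the next stage; lacunarity factors of the viscous and
  tracking sums), the frequencies `Fq s`, viscosities `ν m = μ_m / F_m²` (`ν_pos`, `tendsto_ν`)
  and the read-outs `Cψ1_div_T_le_Fq`, `force_scale_le_Fq`, `visc_scale_le_Fq`,
  `visc_sum_scale_le_Fq`, `track_sum_scale_le_Fq`;
* the drifts `vel m t = Σ_{1 ≤ s ≤ m} stageDrift s t` — at most one stage moves (`vel_eq`) —
  smooth, divergence free, mean zero, vanishing off `(1/2, 1)`, eventually stationary
  (`vel_stationary`) and of uniformly bounded energy (`integral_norm_sq_vel_le`);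
* the Laplacian of a shear drift (`laplacian_drift`), the forces
  `nsBodyForce ν (vel m) t = accForce m t - ν Δ(vel m t)` (`nsBodyForce_vel`: no nonlinear term,
  `convect_vel`), the limit force `gLim` with `‖g^m(t,x) - gLim(t,x)‖ ≤ 2^{-(m+1)} + 2^{-m}`
  (`norm_nsBodyForce_sub_gLim_le`), its continuity in `L²` (`continuousInLpOn_gLim`) and the
  convergence `sup_t ‖g^m(t) - gLim(t)‖_{L²} → 0` (`tendsto_iSup_eLpNorm_nsBodyForce_sub_gLim`).

## References

* A. Cheskidov, *Dissipation anomaly and anomalous dissipation in incompressible fluid flows*,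
  arXiv:2311.04182 (2023), Theorem 1.3, §4, §6. [`Cheskidov2023`]
-/

open MeasureTheory Set Filter Topology Function UnitAddTorus
open scoped ENNReal NNReal ContDiff
open Literature.Analysis.FunctionSpaces.Torus

noncomputable section

namespace Literature.Analysis.FluidPDE

namespace ShearCascade

/-! ## The profile family of the cascade -/

/-- The corner widths `w_s = 2^{-(s+5)}`. [folklore] -/
def wseq (s : ℕ) : ℝ := 1 / 2 ^ (s + 5)

/-- `0 < w_s`. [folklore] -/
theorem wseq_pos (s : ℕ) : 0 < wseq s := by unfold wseq; positivity

/-- `w_s ≤ 1`. [folklore] -/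
theorem wseq_le_one (s : ℕ) : wseq s ≤ 1 := by
  unfold wseq
  rw [div_le_one (by positivity)]
  exact one_le_pow₀ (by norm_num)

/-- **The profile data of the cascade**: the near-triangle waves `S_{w_s}` with residues
`res s = 2 w_s = 2^{-(s+4)}`. [folklore] -/
def cascadePF : ProfileFamily where
  prof s := profile (wseq s) (wseq_pos s) (wseq_le_one s)
  res s := 1 / 2 ^ (s + 4)
  abs_le_one s t := abs_nearTri_le (wseq_pos s) (wseq_le_one s) t
  mean_zero s := intervalIntegral_nearTri (wseq_pos s) (wseq_le_one s)
  res_nonneg s := by positivity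
  res_le s := le_rfl
  oscMean_le s l hl ε hε := by
    have h := norm_oscMean_nearTri_le (wseq_pos s) (wseq_le_one s) hl hε
    have hw : 2 * wseq s = 1 / 2 ^ (s + 4) := by unfold wseq; rw [pow_succ]; field_simp
    rw [hw] at h
    refine le_trans (le_of_eq ?_) h
    rw [oscMean]
    congr 1
    refine intervalIntegral.integral_congr fun t _ => ?_
    simp only [profile_apply]
    push_cast
    ring_nf

/-! ## Bounds of derivatives of smooth periodic functions -/

/-- **A continuous `1`-periodic function is bounded.** [folklore] -/
theorem exists_bound_of_periodic {f : ℝ → ℝ} (hf : Continuous f) (hper : Function.Periodic f 1) :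
    ∃ C, 0 ≤ C ∧ ∀ t, |f t| ≤ C := by
  obtain ⟨C, hC⟩ := isCompact_Icc.exists_bound_of_continuousOn (hf.continuousOn (s := Icc (0 : ℝ) 1))
  refine ⟨max C 0, le_max_right _ _, fun t => ?_⟩
  have h : f t = f (Int.fract t) := by
    have := hper.int_mul (-⌊t⌋) t
    rw [← this]
    congr 1
    rw [Int.fract]
    push_cast
    ring
  rw [h]
  exact ((Real.norm_eq_abs _).symm.le.trans (hC _ ⟨Int.fract_nonneg t, (Int.fract_lt_one t).le⟩)).trans
    (le_max_left _ _)

/-- Derivatives of smooth periodic functions are periodic. [folklore] -/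
theorem periodic_deriv {f : ℝ → ℝ} (hper : Function.Periodic f 1) : Function.Periodic (deriv f) 1 := by
  intro t
  have h : f = fun x => f (x + 1) := funext fun x => (hper x).symm
  conv_rhs => rw [h]
  rw [deriv_comp_add_const]

/-- **Bound of the first derivative of a profile.** [folklore] -/
theorem exists_bound_deriv (P : ShearProfile) : ∃ C, 0 ≤ C ∧ ∀ t, |deriv P t| ≤ C :=
  exists_bound_of_periodic (P.contDiff.continuous_deriv (by simp)) (periodic_deriv P.periodic)

/-- **Bound of the second derivative of a profile.** [folklore] -/
theorem exists_bound_deriv_deriv (P : ShearProfile) : ∃ C, 0 ≤ C ∧ ∀ t, |deriv (deriv P) t| ≤ C :=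
  exists_bound_of_periodic ((contDiff_infty_iff_deriv.mp P.contDiff).2.continuous_deriv (by simp))
    (periodic_deriv (periodic_deriv P.periodic))

/-- A bound `L1 s` for `|S_s'|`. [folklore] -/
def L1 (s : ℕ) : ℝ := Classical.choose (exists_bound_deriv (cascadePF.prof s))

/-- The defining property of `L1`. [folklore] -/
theorem L1_spec (s : ℕ) : 0 ≤ L1 s ∧ ∀ t, |deriv (cascadePF.prof s) t| ≤ L1 s :=
  Classical.choose_spec (exists_bound_deriv (cascadePF.prof s))

/-- A bound `L2 s` for `|S_s''|`. [folklore] -/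
def L2 (s : ℕ) : ℝ := Classical.choose (exists_bound_deriv_deriv (cascadePF.prof s))

/-- The defining property of `L2`. [folklore] -/
theorem L2_spec (s : ℕ) : 0 ≤ L2 s ∧ ∀ t, |deriv (deriv (cascadePF.prof s)) t| ≤ L2 s :=
  Classical.choose_spec (exists_bound_deriv_deriv (cascadePF.prof s))

/-! ## The smooth step and its derivative bounds -/

/-- `smoothTransition` has a bounded derivative. [folklore] -/
theorem exists_bound_deriv_smoothTransition : ∃ C, 0 ≤ C ∧ ∀ t, |deriv Real.smoothTransition t| ≤ C := by
  have hc : Continuous (deriv Real.smoothTransition) := (Real.smoothTransition.contDiff (n := 1)).continuous_deriv le_rfl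
  obtain ⟨C, hC⟩ := isCompact_Icc.exists_bound_of_continuousOn (hc.continuousOn (s := Icc (0 : ℝ) 1))
  refine ⟨max C 0, le_max_right _ _, fun t => ?_⟩
  by_cases ht : t ∈ Icc (0 : ℝ) 1
  · exact ((Real.norm_eq_abs _).symm.le.trans (hC t ht)).trans (le_max_left _ _)
  · have h0 : deriv Real.smoothTransition t = 0 := by
      rw [mem_Icc, not_and_or, not_le, not_le] at ht
      rcases ht with h | h
      · refine IsLocalMin.deriv_eq_zero ?_
        filter_upwards [Iio_mem_nhds h] with s hs
        rw [Real.smoothTransition.zero_of_nonpos (le_of_lt hs), Real.smoothTransition.zero_of_nonpos h.le]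
      · refine IsLocalMax.deriv_eq_zero ?_
        filter_upwards [Ioi_mem_nhds h] with s hs
        rw [Real.smoothTransition.one_of_one_le (le_of_lt hs), Real.smoothTransition.one_of_one_le h.le]
    rw [h0, abs_zero]; exact le_max_right _ _

/-- `smoothTransition` has a bounded second derivative. [folklore] -/
theorem exists_bound_deriv_deriv_smoothTransition : ∃ C, 0 ≤ C ∧ ∀ t, |deriv (deriv Real.smoothTransition) t| ≤ C := by
  have hc : Continuous (deriv (deriv Real.smoothTransition)) :=
    (contDiff_infty_iff_deriv.mp (Real.smoothTransition.contDiff (n := (⊤ : ℕ∞)))).2.continuous_deriv (by simp)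
  obtain ⟨C, hC⟩ := isCompact_Icc.exists_bound_of_continuousOn (hc.continuousOn (s := Icc (0 : ℝ) 1))
  refine ⟨max C 0, le_max_right _ _, fun t => ?_⟩
  by_cases ht : t ∈ Icc (0 : ℝ) 1
  · exact ((Real.norm_eq_abs _).symm.le.trans (hC t ht)).trans (le_max_left _ _)
  · have hconst : ∀ᶠ s in 𝓝 t, deriv Real.smoothTransition s = 0 := by
      rw [mem_Icc, not_and_or, not_le, not_le] at ht
      rcases ht with h | h
      · filter_upwards [Iio_mem_nhds h] with s hs
        refine IsLocalMin.deriv_eq_zero ?_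
        filter_upwards [Iio_mem_nhds hs] with r hr
        rw [Real.smoothTransition.zero_of_nonpos (le_of_lt hr), Real.smoothTransition.zero_of_nonpos (le_of_lt hs)]
      · filter_upwards [Ioi_mem_nhds h] with s hs
        refine IsLocalMax.deriv_eq_zero ?_
        filter_upwards [Ioi_mem_nhds hs] with r hr
        rw [Real.smoothTransition.one_of_one_le (le_of_lt hr), Real.smoothTransition.one_of_one_le (le_of_lt hs)]
    have h0 : deriv (deriv Real.smoothTransition) t = 0 := by
      have heq : deriv Real.smoothTransition =ᶠ[𝓝 t] fun _ => 0 := hconst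
      rw [heq.deriv_eq, deriv_const]
    rw [h0, abs_zero]; exact le_max_right _ _

/-- A bound `Cψ1` for `|ψ'|`, `ψ = smoothTransition`. [folklore] -/
def Cψ1 : ℝ := Classical.choose exists_bound_deriv_smoothTransition

/-- The defining property of `Cψ1`. [folklore] -/
theorem Cψ1_spec : 0 ≤ Cψ1 ∧ ∀ t, |deriv Real.smoothTransition t| ≤ Cψ1 :=
  Classical.choose_spec exists_bound_deriv_smoothTransition

/-- A bound `Cψ2` for `|ψ''|`. [folklore] -/
def Cψ2 : ℝ := Classical.choose exists_bound_deriv_deriv_smoothTransition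

/-- The defining property of `Cψ2`. [folklore] -/
theorem Cψ2_spec : 0 ≤ Cψ2 ∧ ∀ t, |deriv (deriv Real.smoothTransition) t| ≤ Cψ2 :=
  Classical.choose_spec exists_bound_deriv_deriv_smoothTransition

/-! ## The time grid -/

/-- **The slot starts** `σ_s = 1 - 2^{-s}` (`σ_1 = 1/2`, `σ_s ↑ 1`). [folklore] -/
def σ (s : ℕ) : ℝ := 1 - 1 / 2 ^ s

/-- The viscosity scale `μ_s = 64 s 2^s` (`ν_m = μ_m / F_m²`; the factor `s + 1` keeps it positive). [folklore] -/
def μ (s : ℕ) : ℝ := 64 * (s + 1) * 2 ^ s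

/-- `0 ≤ μ_s`. [folklore] -/
theorem μ_nonneg (s : ℕ) : 0 ≤ μ s := by unfold μ; positivity

/-- `1 ≤ μ_s`. [folklore] -/
theorem one_le_μ (s : ℕ) : 1 ≤ μ s := by
  unfold μ
  have h1 : (0 : ℝ) ≤ s := Nat.cast_nonneg s
  have h2 : (1 : ℝ) ≤ 2 ^ s := one_le_pow₀ (by norm_num)
  nlinarith

/-- `0 < μ_s`. [folklore] -/
theorem μ_pos (s : ℕ) : 0 < μ s := lt_of_lt_of_le one_pos (one_le_μ s)

/-- A bound `Γ₀` for the gradient of the datum. [folklore] -/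
def Γ₀ : ℝ := Classical.choose (ShearStage.exists_forall_norm_le isSmooth_rhoIn.gradient)

/-- The defining property of `Γ₀`. [folklore] -/
theorem Γ₀_spec : 0 ≤ Γ₀ ∧ ∀ x, ‖gradient rhoIn x‖ ≤ Γ₀ :=
  Classical.choose_spec (ShearStage.exists_forall_norm_le isSmooth_rhoIn.gradient)

/-- **The frequency-free gradient-growth constants** `Λ_s = Γ₀ ∏_{i ≤ s} (1 + L1 i)`
(so that `sup ‖∇Θ_s‖ ≤ Λ_s F_s`, `ShearCascadeTransport`). [folklore] -/
def Λ (s : ℕ) : ℝ := Γ₀ * ∏ i ∈ Finset.range (s + 1), (1 + L1 i)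

/-- `0 ≤ Λ_s`. [folklore] -/
theorem Λ_nonneg (s : ℕ) : 0 ≤ Λ s := by
  unfold Λ
  exact mul_nonneg Γ₀_spec.1 (Finset.prod_nonneg fun i _ => by have := (L1_spec i).1; positivity)

/-- `Γ₀ ≤ Λ_s` (all factors are `≥ 1`). [folklore] -/
theorem Γ₀_le_Λ (s : ℕ) : Γ₀ ≤ Λ s := by
  unfold Λ
  have h : (1 : ℝ) ≤ ∏ i ∈ Finset.range (s + 1), (1 + L1 i) := by
    refine Finset.induction_on (Finset.range (s + 1)) (by simp) fun a t _ ih => ?_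
    rw [Finset.prod_insert ‹a ∉ t›]
    have := (L1_spec a).1
    nlinarith
  have h0 := Γ₀_spec.1
  nlinarith

/-- The recursion `Λ_{s+1} = Λ_s (1 + L1_{s+1})`. [folklore] -/
theorem Λ_succ (s : ℕ) : Λ (s + 1) = Λ s * (1 + L1 (s + 1)) := by
  unfold Λ
  rw [Finset.prod_range_succ]
  ring

/-- **The active lengths** `T_s = min(2^{-(s+2)}, 1/((s+1)² μ_s Λ_s² + 1))`. [folklore] -/
def T (s : ℕ) : ℝ := min (1 / 2 ^ (s + 2)) (1 / ((s + 1) ^ 2 * μ s * Λ s ^ 2 + 1))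

/-- `0 < T_s`. [folklore] -/
theorem T_pos (s : ℕ) : 0 < T s := by
  unfold T
  refine lt_min (by positivity) ?_
  have := μ_nonneg s
  have := Λ_nonneg s
  positivity

/-- `T_s ≤ 2^{-(s+2)}`. [folklore] -/
theorem T_le (s : ℕ) : T s ≤ 1 / 2 ^ (s + 2) := min_le_left _ _

/-- `T_s ((s+1)² μ_s Λ_s²) ≤ 1` (the tracking budget of the active slot). [folklore] -/
theorem T_mul_le (s : ℕ) : T s * ((s + 1) ^ 2 * μ s * Λ s ^ 2) ≤ 1 := by
  have hμ := μ_nonneg s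
  have hΛ := Λ_nonneg s
  have hx : 0 ≤ ((s : ℝ) + 1) ^ 2 * μ s * Λ s ^ 2 := by positivity
  have h : T s ≤ 1 / ((s + 1) ^ 2 * μ s * Λ s ^ 2 + 1) := min_le_right _ _
  calc T s * ((s + 1) ^ 2 * μ s * Λ s ^ 2) ≤ 1 / ((s + 1) ^ 2 * μ s * Λ s ^ 2 + 1) * ((s + 1) ^ 2 * μ s * Λ s ^ 2) :=
        mul_le_mul_of_nonneg_right h hx
    _ ≤ 1 := by rw [div_mul_eq_mul_div, one_mul, div_le_one (by positivity)]; linarith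

/-- **The idle gaps** `P_s = 2^{-(s+1)} - T_s ≥ 2^{-(s+2)}`. [folklore] -/
def P (s : ℕ) : ℝ := 1 / 2 ^ (s + 1) - T s

/-- `2^{-(s+2)} ≤ P_s`. [folklore] -/
theorem P_ge (s : ℕ) : 1 / 2 ^ (s + 2) ≤ P s := by
  unfold P
  have h := T_le s
  have e : (1 : ℝ) / 2 ^ (s + 1) = 1 / 2 ^ (s + 2) + 1 / 2 ^ (s + 2) := by
    rw [pow_succ, pow_succ]; field_simp; ring
  linarith

/-- `0 < P_s`. [folklore] -/
theorem P_pos (s : ℕ) : 0 < P s := lt_of_lt_of_le (by positivity) (P_ge s)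

/-- **The grid identity** `σ_{s+1} = σ_s + T_s + P_s`. [folklore] -/
theorem σ_succ (s : ℕ) : σ (s + 1) = σ s + T s + P s := by
  unfold σ P
  rw [pow_succ]; field_simp; ring

/-- `σ_1 = 1/2`. [folklore] -/
theorem σ_one : σ 1 = 2⁻¹ := by norm_num [σ]

/-- `σ_s < 1`. [folklore] -/
theorem σ_lt_one (s : ℕ) : σ s < 1 := by
  unfold σ
  have : (0 : ℝ) < 1 / 2 ^ s := by positivity
  linarith

/-- `1/2 ≤ σ_s` for `s ≥ 1`. [folklore] -/
theorem half_le_σ {s : ℕ} (hs : 1 ≤ s) : 2⁻¹ ≤ σ s := by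
  unfold σ
  have h2 : (2 : ℝ) ^ 1 ≤ 2 ^ s := pow_le_pow_right₀ (by norm_num) hs
  have : (1 : ℝ) / 2 ^ s ≤ 1 / 2 ^ 1 := div_le_div_of_nonneg_left (by norm_num) (by norm_num) h2
  norm_num at this ⊢
  linarith

/-- The slot ends before the next slot starts: `σ_s + T_s < σ_{s+1}`. [folklore] -/
theorem σ_add_T_lt (s : ℕ) : σ s + T s < σ (s + 1) := by
  rw [σ_succ]; linarith [P_pos s]

/-- `σ` is strictly increasing. [folklore] -/
theorem σ_strictMono : StrictMono σ := by
  refine strictMono_nat_of_lt_succ fun s => ?_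
  have := σ_add_T_lt s
  linarith [T_pos s]

/-- `σ_s → 1`. [folklore] -/
theorem tendsto_σ : Tendsto σ atTop (𝓝 1) := by
  unfold σ
  have h : Tendsto (fun s : ℕ => (1 : ℝ) / 2 ^ s) atTop (𝓝 0) := by
    simp_rw [one_div, ← inv_pow]
    exact tendsto_pow_atTop_nhds_zero_of_lt_one (by norm_num) (by norm_num)
  have h2 : Tendsto (fun s : ℕ => (1 : ℝ) - 1 / 2 ^ s) atTop (𝓝 (1 - 0)) := tendsto_const_nhds.sub h
  rwa [sub_zero] at h2

/-! ## The amplitude functions -/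

/-- **The amplitude of stage `s`**: `a_s(t) = ψ((t - σ_s)/T_s)`, `ψ = smoothTransition` — `0`
before the slot, `1` after it, smooth and monotone in between. [folklore] -/
def amp (s : ℕ) (t : ℝ) : ℝ := Real.smoothTransition ((t - σ s) / T s)

/-- `a_s` is smooth. [folklore] -/
theorem contDiff_amp (s : ℕ) {n : ℕ∞} : ContDiff ℝ n (amp s) :=
  Real.smoothTransition.contDiff.comp ((contDiff_id.sub contDiff_const).div_const _)

/-- `a_s t = 0` for `t ≤ σ_s`. [folklore] -/
theorem amp_of_le {s : ℕ} {t : ℝ} (ht : t ≤ σ s) : amp s t = 0 :=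
  Real.smoothTransition.zero_of_nonpos (div_nonpos_of_nonpos_of_nonneg (by linarith) (T_pos s).le)

/-- `a_s t = 1` for `t ≥ σ_s + T_s`. [folklore] -/
theorem amp_of_ge {s : ℕ} {t : ℝ} (ht : σ s + T s ≤ t) : amp s t = 1 :=
  Real.smoothTransition.one_of_one_le ((one_le_div (T_pos s)).2 (by linarith))

/-- `0 ≤ a_s ≤ 1`. [folklore] -/
theorem amp_mem_Icc (s : ℕ) (t : ℝ) : amp s t ∈ Icc (0 : ℝ) 1 :=
  ⟨Real.smoothTransition.nonneg _, Real.smoothTransition.le_one _⟩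

/-- The chain rule for `a_s`. [folklore] -/
theorem hasDerivAt_amp (s : ℕ) (t : ℝ) :
    HasDerivAt (amp s) (deriv Real.smoothTransition ((t - σ s) / T s) * (1 / T s)) t := by
  have h1 : HasDerivAt (fun t => (t - σ s) / T s) (1 / T s) t := by
    simpa using ((hasDerivAt_id t).sub_const (σ s)).div_const (T s)
  have h2 : HasDerivAt Real.smoothTransition (deriv Real.smoothTransition ((t - σ s) / T s)) ((t - σ s) / T s) :=
    ((Real.smoothTransition.contDiff (n := 1)).differentiable (by simp)).differentiableAt.hasDerivAt
  exact h2.comp t h1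

/-- `a_s' t = ψ'((t - σ_s)/T_s) / T_s`. [folklore] -/
theorem deriv_amp (s : ℕ) (t : ℝ) : deriv (amp s) t = deriv Real.smoothTransition ((t - σ s) / T s) / T s := by
  rw [(hasDerivAt_amp s t).deriv]; ring

/-- **`|a_s'| ≤ Cψ1 / T_s`.** [folklore] -/
theorem abs_deriv_amp_le (s : ℕ) (t : ℝ) : |deriv (amp s) t| ≤ Cψ1 / T s := by
  rw [deriv_amp, abs_div, abs_of_pos (T_pos s)]
  exact div_le_div_of_nonneg_right (Cψ1_spec.2 _) (T_pos s).le

/-- The second derivative of `a_s`. [folklore] -/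
theorem deriv_deriv_amp (s : ℕ) (t : ℝ) :
    deriv (deriv (amp s)) t = deriv (deriv Real.smoothTransition) ((t - σ s) / T s) / T s ^ 2 := by
  have h1 : HasDerivAt (fun t => (t - σ s) / T s) (1 / T s) t := by
    simpa using ((hasDerivAt_id t).sub_const (σ s)).div_const (T s)
  have h2 : HasDerivAt (deriv Real.smoothTransition) (deriv (deriv Real.smoothTransition) ((t - σ s) / T s)) ((t - σ s) / T s) :=
    ((contDiff_infty_iff_deriv.mp (Real.smoothTransition.contDiff (n := (⊤ : ℕ∞)))).2.differentiable (by simp)).differentiableAt.hasDerivAt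
  have h3 := (h2.comp t h1).div_const (T s)
  have hfun : deriv (amp s) = fun t => (deriv Real.smoothTransition ∘ fun t => (t - σ s) / T s) t / T s :=
    funext fun t => deriv_amp s t
  rw [hfun, h3.deriv]
  field_simp

/-- **`|a_s''| ≤ Cψ2 / T_s²`.** [folklore] -/
theorem abs_deriv_deriv_amp_le (s : ℕ) (t : ℝ) : |deriv (deriv (amp s)) t| ≤ Cψ2 / T s ^ 2 := by
  rw [deriv_deriv_amp, abs_div, abs_of_pos (pow_pos (T_pos s) 2)]
  exact div_le_div_of_nonneg_right (Cψ2_spec.2 _) (pow_pos (T_pos s) 2).le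

/-- **Flatness off the slot**: `a_s' t = 0` unless `σ_s < t < σ_s + T_s`. [folklore] -/
theorem deriv_amp_eq_zero {s : ℕ} {t : ℝ} (ht : t ∉ Ioo (σ s) (σ s + T s)) : deriv (amp s) t = 0 := by
  rw [mem_Ioo, not_and_or, not_lt, not_lt] at ht
  rcases ht with h | h
  · refine IsLocalMin.deriv_eq_zero ?_
    filter_upwards with r
    rw [amp_of_le h]
    exact (amp_mem_Icc s r).1
  · refine IsLocalMax.deriv_eq_zero ?_
    filter_upwards with r
    rw [amp_of_ge h]
    exact (amp_mem_Icc s r).2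

/-- `a_s'` vanishes on a neighbourhood of any time outside the open slot closure-free region:
for `t < σ_s` or `t > σ_s + T_s`, eventually `a_s' = 0`. [folklore] -/
theorem eventually_deriv_amp_eq_zero {s : ℕ} {t : ℝ} (ht : t < σ s ∨ σ s + T s < t) :
    ∀ᶠ r in 𝓝 t, deriv (amp s) r = 0 := by
  rcases ht with h | h
  · filter_upwards [Iio_mem_nhds h] with r hr using deriv_amp_eq_zero fun hm => by linarith [hm.1, mem_Iio.1 hr]
  · filter_upwards [Ioi_mem_nhds h] with r hr using deriv_amp_eq_zero fun hm => by linarith [hm.2, mem_Ioi.1 hr]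

/-- `a_s` is monotone. [folklore] -/
theorem monotone_amp (s : ℕ) : Monotone (amp s) := fun r r' h =>
  Real.smoothTransition.monotone (div_le_div_of_nonneg_right (by linarith) (T_pos s).le)

/-- `0 ≤ a_s'`. [folklore] -/
theorem deriv_amp_nonneg (s : ℕ) (t : ℝ) : 0 ≤ deriv (amp s) t := (monotone_amp s).deriv_nonneg

/-- **The second derivative is flat off the open slot too**: where `a_s' = 0`, the nonnegative
function `a_s'` has a local minimum. [folklore] -/
theorem deriv_deriv_amp_eq_zero {s : ℕ} {t : ℝ} (ht : t ∉ Ioo (σ s) (σ s + T s)) : deriv (deriv (amp s)) t = 0 := by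
  refine IsLocalMin.deriv_eq_zero ?_
  filter_upwards with r
  rw [deriv_amp_eq_zero ht]
  exact deriv_amp_nonneg s r

/-- **Dichotomy of the slots**: at a time `t ≥ σ_s` every earlier stage `r < s` is finished
(`a_r = 1` near `t`, `a_r' = 0` near `t`). [folklore] -/
theorem amp_eq_one_of_lt {r s : ℕ} (hrs : r < s) {t : ℝ} (ht : σ s ≤ t) : amp r t = 1 := by
  refine amp_of_ge ?_
  have h1 := σ_add_T_lt r
  have h2 : σ (r + 1) ≤ σ s := σ_strictMono.monotone hrs
  linarith

/-- At a time `t ≥ σ_s`, the earlier amplitudes are locally constant. [folklore] -/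
theorem eventually_deriv_amp_eq_zero_of_lt {r s : ℕ} (hrs : r < s) {t : ℝ} (ht : σ s ≤ t) :
    ∀ᶠ τ in 𝓝 t, deriv (amp r) τ = 0 := by
  refine eventually_deriv_amp_eq_zero (Or.inr ?_)
  have h1 := σ_add_T_lt r
  have h2 : σ (r + 1) ≤ σ s := σ_strictMono.monotone hrs
  linarith

/-- Before `σ_s`, the amplitude `a_s` vanishes near `t`. [folklore] -/
theorem eventually_amp_eq_zero {s : ℕ} {t : ℝ} (ht : t < σ s) : ∀ᶠ τ in 𝓝 t, amp s τ = 0 := by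
  filter_upwards [Iio_mem_nhds ht] with τ hτ using amp_of_le (le_of_lt hτ)

/-- The slots lie in `(1/2, 1)`: if `a_s' t ≠ 0` then `1/2 < t < 1` (`s ≥ 1`). [folklore] -/
theorem mem_Ioo_of_deriv_amp_ne_zero {s : ℕ} (hs : 1 ≤ s) {t : ℝ} (h : deriv (amp s) t ≠ 0) : t ∈ Ioo (2⁻¹ : ℝ) 1 := by
  by_contra hnot
  apply h
  apply deriv_amp_eq_zero
  rintro ⟨h1, h2⟩
  apply hnot
  have := half_le_σ hs
  have := σ_add_T_lt s
  have := σ_lt_one (s + 1)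
  exact ⟨by linarith, by linarith⟩

/-! ## The active stage at a time -/

/-- Two different slots are disjoint: a time lies in at most one open slot. [folklore] -/
theorem slot_unique {s s' : ℕ} {t : ℝ} (hs : t ∈ Ioo (σ s) (σ s + T s)) (hs' : t ∈ Ioo (σ s') (σ s' + T s')) : s = s' := by
  by_contra hne
  rcases lt_or_gt_of_ne hne with h | h
  · have h1 := σ_add_T_lt s
    have h2 : σ (s + 1) ≤ σ s' := σ_strictMono.monotone (Nat.succ_le_of_lt h)
    linarith [hs.2, hs'.1]
  · have h1 := σ_add_T_lt s'
    have h2 : σ (s' + 1) ≤ σ s := σ_strictMono.monotone (Nat.succ_le_of_lt h)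
    linarith [hs'.2, hs.1]

open Classical in
/-- **The active stage** at time `t` (the unique `s` with `σ_s < t < σ_s + T_s`; `0` if none). [folklore] -/
def act (t : ℝ) : ℕ := if h : ∃ s, t ∈ Ioo (σ s) (σ s + T s) then Nat.find h else 0

/-- If `t` lies in the open slot of stage `s`, then `s` is the active stage. [folklore] -/
theorem act_eq_of_mem {s : ℕ} {t : ℝ} (hs : t ∈ Ioo (σ s) (σ s + T s)) : act t = s := by
  classical
  have h : ∃ s, t ∈ Ioo (σ s) (σ s + T s) := ⟨s, hs⟩
  rw [act, dif_pos h]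
  exact slot_unique (Nat.find_spec h) hs

/-- **Inactive stages do not move**: `a_s' t = 0` unless `s` is the active stage. [folklore] -/
theorem deriv_amp_eq_zero_of_ne_act {s : ℕ} {t : ℝ} (h : s ≠ act t) : deriv (amp s) t = 0 :=
  deriv_amp_eq_zero fun hs => h (act_eq_of_mem hs).symm

/-- The same for the second derivative. [folklore] -/
theorem deriv_deriv_amp_eq_zero_of_ne_act {s : ℕ} {t : ℝ} (h : s ≠ act t) : deriv (deriv (amp s)) t = 0 :=
  deriv_deriv_amp_eq_zero fun hs => h (act_eq_of_mem hs).symm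

/-! ## The external constraints and the viscosities -/

/-- The viscous weight `κ_r = Cψ1 L2_r / (2 T_r)` of stage `r`. [folklore] -/
def κ (r : ℕ) : ℝ := Cψ1 * L2 r / (2 * T r)

/-- `0 ≤ κ_r`. [folklore] -/
theorem κ_nonneg (r : ℕ) : 0 ≤ κ r := by
  unfold κ
  have := Cψ1_spec.1; have := (L2_spec r).1; have := T_pos r
  positivity

/-- **The external constraints** fed into the frequency recursion of `ShearCascadeInviscid`:
`F_s` must dominate (the energy, inviscid-force and viscous-force scales of stage `s+1`) and
`F_{s-1}` times (the lacunarity factors of the viscous-force and tracking sums over the stages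
`< s`). [folklore] -/
def extra (s : ℕ) (g : ℕ → ℕ) : ℕ :=
  ⌈Cψ1 / T (s + 1) + 2 ^ (s + 1) * Cψ2 / T (s + 1) ^ 2 + 2 ^ (s + 1) * μ (s + 1) * Cψ1 * L2 (s + 1) / T (s + 1) +
    g (s - 1) * (2 ^ s * μ s * (1 + ∑ r ∈ Finset.range s, κ r) +
      s * μ s * (1 + ∑ r ∈ Finset.range s, (T r + P r + 1) * Λ r ^ 2))⌉₊

/-- **The frequencies of the cascade.** [folklore] -/
def Fq (s : ℕ) : ℕ := cascadePF.F extra s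

/-- `Fq` as a real number is positive. [folklore] -/
theorem Fq_pos (s : ℕ) : (0 : ℝ) < Fq s := cascadePF.F_pos extra s

/-- `1 ≤ Fq s`. [folklore] -/
theorem one_le_Fq (s : ℕ) : (1 : ℝ) ≤ Fq s := by exact_mod_cast cascadePF.one_le_F extra s

/-- **The viscosities** `ν_m = μ_m / F_m²`. [folklore] -/
def ν (m : ℕ) : ℝ := μ m / (Fq m) ^ 2

/-- The external constraint is met by the frequencies: the real inequality behind `extra_le_F`. [folklore] -/
theorem extra_real_le_Fq {s : ℕ} (hs : 1 ≤ s) :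
    Cψ1 / T (s + 1) + 2 ^ (s + 1) * Cψ2 / T (s + 1) ^ 2 + 2 ^ (s + 1) * μ (s + 1) * Cψ1 * L2 (s + 1) / T (s + 1) +
      Fq (s - 1) * (2 ^ s * μ s * (1 + ∑ r ∈ Finset.range s, κ r) +
        s * μ s * (1 + ∑ r ∈ Finset.range s, (T r + P r + 1) * Λ r ^ 2)) ≤ Fq s := by
  have h := cascadePF.extra_le_F extra hs
  have htr : trunc (cascadePF.F extra) (s - 1) (s - 1) = Fq (s - 1) := trunc_apply_of_le le_rfl
  have h1 : extra s (trunc (cascadePF.F extra) (s - 1)) =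
      ⌈Cψ1 / T (s + 1) + 2 ^ (s + 1) * Cψ2 / T (s + 1) ^ 2 + 2 ^ (s + 1) * μ (s + 1) * Cψ1 * L2 (s + 1) / T (s + 1) +
        Fq (s - 1) * (2 ^ s * μ s * (1 + ∑ r ∈ Finset.range s, κ r) +
          s * μ s * (1 + ∑ r ∈ Finset.range s, (T r + P r + 1) * Λ r ^ 2))⌉₊ := by
    rw [extra, htr]
  rw [h1] at h
  have h2 : ((⌈Cψ1 / T (s + 1) + 2 ^ (s + 1) * Cψ2 / T (s + 1) ^ 2 + 2 ^ (s + 1) * μ (s + 1) * Cψ1 * L2 (s + 1) / T (s + 1) +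
        Fq (s - 1) * (2 ^ s * μ s * (1 + ∑ r ∈ Finset.range s, κ r) +
          s * μ s * (1 + ∑ r ∈ Finset.range s, (T r + P r + 1) * Λ r ^ 2))⌉₊ : ℕ) : ℝ) ≤ Fq s := by
    exact_mod_cast h
  exact (Nat.le_ceil _).trans h2

/-- Stage `s+1`'s energy scale: `Cψ1 / T_{s+1} ≤ F_s` (`s ≥ 1`). [folklore] -/
theorem Cψ1_div_T_le_Fq {s : ℕ} (hs : 1 ≤ s) : Cψ1 / T (s + 1) ≤ Fq s := by
  have h := extra_real_le_Fq hs
  have h1 : (0 : ℝ) ≤ 2 ^ (s + 1) * Cψ2 / T (s + 1) ^ 2 := by have := Cψ2_spec.1; have := T_pos (s+1); positivity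
  have h2 : (0 : ℝ) ≤ 2 ^ (s + 1) * μ (s + 1) * Cψ1 * L2 (s + 1) / T (s + 1) := by
    have := Cψ1_spec.1; have := (L2_spec (s+1)).1; have := T_pos (s+1); have := μ_nonneg (s+1); positivity
  have h3 : (0 : ℝ) ≤ Fq (s - 1) * (2 ^ s * μ s * (1 + ∑ r ∈ Finset.range s, κ r) +
      s * μ s * (1 + ∑ r ∈ Finset.range s, (T r + P r + 1) * Λ r ^ 2)) := by
    have := Fq_pos (s - 1); have := μ_nonneg s
    have hκ : 0 ≤ ∑ r ∈ Finset.range s, κ r := Finset.sum_nonneg fun r _ => κ_nonneg r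
    have hΛ : 0 ≤ ∑ r ∈ Finset.range s, (T r + P r + 1) * Λ r ^ 2 :=
      Finset.sum_nonneg fun r _ => by have := T_pos r; have := P_pos r; positivity
    have hF0 := (Fq_pos (s - 1)).le
    have hμ0 := μ_nonneg s
    have h2s : (0 : ℝ) ≤ 2 ^ s := by positivity
    have hs0 : (0 : ℝ) ≤ s := Nat.cast_nonneg s
    exact mul_nonneg hF0 (add_nonneg (mul_nonneg (mul_nonneg h2s hμ0) (by linarith))
      (mul_nonneg (mul_nonneg hs0 hμ0) (by linarith)))
  linarith

/-- Stage `s+1`'s inviscid-force scale: `2^{s+1} Cψ2 / T_{s+1}² ≤ F_s` (`s ≥ 1`). [folklore] -/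
theorem force_scale_le_Fq {s : ℕ} (hs : 1 ≤ s) : 2 ^ (s + 1) * Cψ2 / T (s + 1) ^ 2 ≤ Fq s := by
  have h := extra_real_le_Fq hs
  have h1 : (0 : ℝ) ≤ Cψ1 / T (s + 1) := by have := Cψ1_spec.1; have := T_pos (s+1); positivity
  have h2 : (0 : ℝ) ≤ 2 ^ (s + 1) * μ (s + 1) * Cψ1 * L2 (s + 1) / T (s + 1) := by
    have := Cψ1_spec.1; have := (L2_spec (s+1)).1; have := T_pos (s+1); have := μ_nonneg (s+1); positivity
  have h3 : (0 : ℝ) ≤ Fq (s - 1) * (2 ^ s * μ s * (1 + ∑ r ∈ Finset.range s, κ r) +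
      s * μ s * (1 + ∑ r ∈ Finset.range s, (T r + P r + 1) * Λ r ^ 2)) := by
    have := Fq_pos (s - 1); have := μ_nonneg s
    have hκ : 0 ≤ ∑ r ∈ Finset.range s, κ r := Finset.sum_nonneg fun r _ => κ_nonneg r
    have hΛ : 0 ≤ ∑ r ∈ Finset.range s, (T r + P r + 1) * Λ r ^ 2 :=
      Finset.sum_nonneg fun r _ => by have := T_pos r; have := P_pos r; positivity
    have hF0 := (Fq_pos (s - 1)).le
    have hμ0 := μ_nonneg s
    have h2s : (0 : ℝ) ≤ 2 ^ s := by positivity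
    have hs0 : (0 : ℝ) ≤ s := Nat.cast_nonneg s
    exact mul_nonneg hF0 (add_nonneg (mul_nonneg (mul_nonneg h2s hμ0) (by linarith))
      (mul_nonneg (mul_nonneg hs0 hμ0) (by linarith)))
  linarith

/-- Stage `s+1`'s viscous-force scale: `2^{s+1} μ_{s+1} Cψ1 L2_{s+1} / T_{s+1} ≤ F_s` (`s ≥ 1`). [folklore] -/
theorem visc_scale_le_Fq {s : ℕ} (hs : 1 ≤ s) : 2 ^ (s + 1) * μ (s + 1) * Cψ1 * L2 (s + 1) / T (s + 1) ≤ Fq s := by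
  have h := extra_real_le_Fq hs
  have h1 : (0 : ℝ) ≤ Cψ1 / T (s + 1) := by have := Cψ1_spec.1; have := T_pos (s+1); positivity
  have h2 : (0 : ℝ) ≤ 2 ^ (s + 1) * Cψ2 / T (s + 1) ^ 2 := by have := Cψ2_spec.1; have := T_pos (s+1); positivity
  have h3 : (0 : ℝ) ≤ Fq (s - 1) * (2 ^ s * μ s * (1 + ∑ r ∈ Finset.range s, κ r) +
      s * μ s * (1 + ∑ r ∈ Finset.range s, (T r + P r + 1) * Λ r ^ 2)) := by
    have := Fq_pos (s - 1); have := μ_nonneg s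
    have hκ : 0 ≤ ∑ r ∈ Finset.range s, κ r := Finset.sum_nonneg fun r _ => κ_nonneg r
    have hΛ : 0 ≤ ∑ r ∈ Finset.range s, (T r + P r + 1) * Λ r ^ 2 :=
      Finset.sum_nonneg fun r _ => by have := T_pos r; have := P_pos r; positivity
    have hF0 := (Fq_pos (s - 1)).le
    have hμ0 := μ_nonneg s
    have h2s : (0 : ℝ) ≤ 2 ^ s := by positivity
    have hs0 : (0 : ℝ) ≤ s := Nat.cast_nonneg s
    exact mul_nonneg hF0 (add_nonneg (mul_nonneg (mul_nonneg h2s hμ0) (by linarith))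
      (mul_nonneg (mul_nonneg hs0 hμ0) (by linarith)))
  linarith

/-- **The lacunarity factor of the viscous-force sum**: `F_{s-1} 2^s μ_s (1 + Σ_{r<s} κ_r) ≤ F_s`. [folklore] -/
theorem visc_sum_scale_le_Fq {s : ℕ} (hs : 1 ≤ s) : Fq (s - 1) * (2 ^ s * μ s * (1 + ∑ r ∈ Finset.range s, κ r)) ≤ Fq s := by
  have h := extra_real_le_Fq hs
  have h1 : (0 : ℝ) ≤ Cψ1 / T (s + 1) := by have := Cψ1_spec.1; have := T_pos (s+1); positivity
  have h2 : (0 : ℝ) ≤ 2 ^ (s + 1) * Cψ2 / T (s + 1) ^ 2 := by have := Cψ2_spec.1; have := T_pos (s+1); positivity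
  have h2' : (0 : ℝ) ≤ 2 ^ (s + 1) * μ (s + 1) * Cψ1 * L2 (s + 1) / T (s + 1) := by
    have := Cψ1_spec.1; have := (L2_spec (s+1)).1; have := T_pos (s+1); have := μ_nonneg (s+1); positivity
  have h3 : (0 : ℝ) ≤ Fq (s - 1) * (s * μ s * (1 + ∑ r ∈ Finset.range s, (T r + P r + 1) * Λ r ^ 2)) := by
    have hΛ : 0 ≤ ∑ r ∈ Finset.range s, (T r + P r + 1) * Λ r ^ 2 :=
      Finset.sum_nonneg fun r _ => by have := T_pos r; have := P_pos r; positivity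
    have hF0 := (Fq_pos (s - 1)).le
    have hμ0 := μ_nonneg s
    have hs0 : (0 : ℝ) ≤ s := Nat.cast_nonneg s
    exact mul_nonneg hF0 (mul_nonneg (mul_nonneg hs0 hμ0) (by linarith))
  nlinarith

/-- **The lacunarity factor of the tracking sum**: `F_{s-1} s μ_s (1 + Σ_{r<s} (T_r+P_r)Λ_r²) ≤ F_s`. [folklore] -/
theorem track_sum_scale_le_Fq {s : ℕ} (hs : 1 ≤ s) :
    Fq (s - 1) * (s * μ s * (1 + ∑ r ∈ Finset.range s, (T r + P r + 1) * Λ r ^ 2)) ≤ Fq s := by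
  have h := extra_real_le_Fq hs
  have h1 : (0 : ℝ) ≤ Cψ1 / T (s + 1) := by have := Cψ1_spec.1; have := T_pos (s+1); positivity
  have h2 : (0 : ℝ) ≤ 2 ^ (s + 1) * Cψ2 / T (s + 1) ^ 2 := by have := Cψ2_spec.1; have := T_pos (s+1); positivity
  have h2' : (0 : ℝ) ≤ 2 ^ (s + 1) * μ (s + 1) * Cψ1 * L2 (s + 1) / T (s + 1) := by
    have := Cψ1_spec.1; have := (L2_spec (s+1)).1; have := T_pos (s+1); have := μ_nonneg (s+1); positivity
  have h3 : (0 : ℝ) ≤ Fq (s - 1) * (2 ^ s * μ s * (1 + ∑ r ∈ Finset.range s, κ r)) := by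
    have hκ : 0 ≤ ∑ r ∈ Finset.range s, κ r := Finset.sum_nonneg fun r _ => κ_nonneg r
    have hF0 := (Fq_pos (s - 1)).le
    have hμ0 := μ_nonneg s
    have h2s : (0 : ℝ) ≤ 2 ^ s := by positivity
    exact mul_nonneg hF0 (mul_nonneg (mul_nonneg h2s hμ0) (by linarith))
  nlinarith

/-! ## The stage drifts and the cascade drifts -/

/-- The flat two-torus (local notation). [folklore] -/
local notation "𝕋²" => UnitAddTorus (Fin 2)
/-- `ℝ²` (local notation). [folklore] -/
local notation "E²" => EuclideanSpace ℝ (Fin 2)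

/-- The stage profiles of the cascade `Q_s = D_s S_s(F_s ·)`. [folklore] -/
def stQ (s : ℕ) : ShearProfile := cascadePF.stP extra s

/-- The displacement of stage `s`, `D_s = 1/(2F_{s-1})`. [folklore] -/
def Ds (s : ℕ) : ℝ := disp (cascadePF.F extra) s

/-- `D_s = 1 / (2 F_{s-1})`. [folklore] -/
theorem Ds_eq (s : ℕ) : Ds s = 1 / (2 * Fq (s - 1)) := rfl

/-- `0 < D_s`. [folklore] -/
theorem Ds_pos (s : ℕ) : 0 < Ds s := cascadePF.disp_pos extra s

/-- `|Q_s| ≤ D_s`. [folklore] -/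
theorem abs_stQ_le (s : ℕ) (t : ℝ) : |stQ s t| ≤ Ds s := cascadePF.abs_stP_le extra s t

/-- `∫₀¹ Q_s = 0`. [folklore] -/
theorem intervalIntegral_stQ (s : ℕ) : ∫ t in (0 : ℝ)..1, stQ s t = 0 := by
  unfold stQ ProfileFamily.stP ProfileFamily.stageProfile
  simp only [ShearProfile.scale_apply]
  rw [intervalIntegral.integral_const_mul]
  have h := intervalIntegral_comp_natCast_mul (g := fun t => cascadePF.prof s t) (cascadePF.prof s).continuous
    (cascadePF.prof s).periodic (cascadePF.one_le_F extra s)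
  rw [h, cascadePF.mean_zero s, mul_zero]

/-- **The drift of stage `s` at time `t`**: `ȧ_s(t) Q_s(x_{u_{s+1}}) e_{u_s}`. [folklore] -/
def stageDrift (s : ℕ) (t : ℝ) : 𝕋² → E² := ShearStage.drift (dir s) (dir (s + 1)) (stQ s) (deriv (amp s) t)

/-- **The drift of the `m`-truncated cascade**: the stages `1 ≤ s ≤ m`. [folklore] -/
def vel (m : ℕ) (t : ℝ) (x : 𝕋²) : E² := ∑ s ∈ Finset.Icc 1 m, stageDrift s t x

/-- The stage drift vanishes when the stage is inactive. [folklore] -/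
theorem stageDrift_eq_zero_of_ne_act {s : ℕ} {t : ℝ} (h : s ≠ act t) : stageDrift s t = 0 := by
  rw [stageDrift, deriv_amp_eq_zero_of_ne_act h, ShearStage.drift_zero]

/-- **At most one stage moves**: the cascade drift is the active stage's drift, or zero. [folklore] -/
theorem vel_eq (m : ℕ) (t : ℝ) : vel m t = if act t ∈ Finset.Icc 1 m then stageDrift (act t) t else 0 := by
  funext x
  rw [vel]
  split_ifs with h
  · rw [Finset.sum_eq_single_of_mem (act t) h]
    intro s _ hs
    rw [stageDrift_eq_zero_of_ne_act hs]; rfl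
  · rw [Finset.sum_eq_zero]
    · rfl
    · intro s hs
      rw [stageDrift_eq_zero_of_ne_act (fun h' => h (h' ▸ hs))]; rfl

/-- The stage drift is smooth in space–time. [folklore] -/
theorem isSmoothSpaceTimeOn_stageDrift (s : ℕ) : FunctionSpaces.Torus.IsSmoothSpaceTimeOn univ (stageDrift s) :=
  ShearStage.isSmoothSpaceTimeOn_drift _ _ _ (contDiff_infty_iff_deriv.mp (contDiff_amp s)).2 univ

/-- **The cascade drift is smooth** on `ℝ × T²`. [folklore] -/
theorem isSmoothSpaceTimeOn_vel (m : ℕ) : FunctionSpaces.Torus.IsSmoothSpaceTimeOn univ (vel m) :=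
  FunctionSpaces.Torus.IsSmoothSpaceTimeOn.sum fun s _ => isSmoothSpaceTimeOn_stageDrift s

/-- Slices of the drift are smooth. [folklore] -/
theorem isSmooth_vel (m : ℕ) (t : ℝ) : IsSmooth (vel m t) := (isSmoothSpaceTimeOn_vel m).isSmooth_slice (mem_univ t)

/-- The zero field is divergence free. [folklore] -/
theorem isDivFree_zero : IsDivFree (0 : 𝕋² → E²) := by
  intro x
  simp [FunctionSpaces.Torus.divergence, FunctionSpaces.Torus.partialDeriv, FunctionSpaces.Torus.lineDeriv]

/-- **The cascade drift is divergence free.** [folklore] -/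
theorem isDivFree_vel (m : ℕ) (t : ℝ) : IsDivFree (vel m t) := by
  rw [vel_eq]
  split_ifs
  · exact ShearStage.isDivFree_drift (dir_succ_ne (act t)).symm _ _
  · exact isDivFree_zero

/-- **The cascade drift has zero mean.** [folklore] -/
theorem hasZeroMean_vel (m : ℕ) (t : ℝ) : HasZeroMean (vel m t) := by
  rw [vel_eq]
  split_ifs
  · exact ShearStage.hasZeroMean_drift _ _ (intervalIntegral_stQ _) _
  · simp [HasZeroMean]

/-- Stages `s ≥ 1` do not move outside `(1/2, 1)`. [folklore] -/
theorem stageDrift_eq_zero_of_not_mem {s : ℕ} (hs : 1 ≤ s) {t : ℝ} (ht : t ∉ Ioo (2⁻¹ : ℝ) 1) : stageDrift s t = 0 := by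
  have h : deriv (amp s) t = 0 := by
    by_contra h
    exact ht (mem_Ioo_of_deriv_amp_ne_zero hs h)
  rw [stageDrift, h, ShearStage.drift_zero]

/-- **The cascade drift vanishes off `(1/2, 1)`**, in particular off `(0, 1)`. [folklore] -/
theorem vel_eq_zero_of_not_mem {m : ℕ} {t : ℝ} (ht : t ∉ Ioo (2⁻¹ : ℝ) 1) : vel m t = 0 := by
  funext x
  rw [vel, Finset.sum_eq_zero]
  · rfl
  · intro s hs
    rw [stageDrift_eq_zero_of_not_mem (Finset.mem_Icc.1 hs).1 ht]; rfl

/-- The cascade drift vanishes off `(0, 1)`. [folklore] -/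
theorem vel_eq_zero {m : ℕ} {t : ℝ} (ht : t ∉ Ioo (0 : ℝ) 1) : vel m t = 0 :=
  vel_eq_zero_of_not_mem fun h => ht ⟨by linarith [h.1], h.2⟩

/-- **Eventual stationarity**: on `[0, T']`, `T' < 1`, the drifts `vel m` do not depend on
`m ≥ m₁` (the stages `> m₁` start after `T'`). [folklore] -/
theorem vel_stationary {T' : ℝ} (hT' : T' < 1) : ∃ m₁ : ℕ, ∀ m ≥ m₁, ∀ t ≤ T', vel m t = vel m₁ t := by
  obtain ⟨m₁, hm₁⟩ := ((tendsto_σ.eventually (Ioi_mem_nhds hT'))).exists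
  have hm₁' : T' < σ m₁ := hm₁
  refine ⟨m₁, fun m hm t ht => ?_⟩
  funext x
  rw [vel, vel, ← Finset.sum_sdiff (Finset.Icc_subset_Icc_right hm)]
  rw [Finset.sum_eq_zero, zero_add]
  intro s hs
  rw [Finset.mem_sdiff, Finset.mem_Icc, Finset.mem_Icc] at hs
  have hs1 : m₁ < s := by omega
  have hσ : σ m₁ ≤ σ s := σ_strictMono.monotone hs1.le
  rw [stageDrift, deriv_amp_eq_zero, ShearStage.drift_zero]
  · rfl
  · rintro ⟨h1, _⟩
    linarith

/-- **Uniform bound of the stage drifts**: `‖stageDrift s t x‖ ≤ Cψ1 / (2 T_s F_{s-1})`. [folklore] -/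
theorem norm_stageDrift_le (s : ℕ) (t : ℝ) (x : 𝕋²) : ‖stageDrift s t x‖ ≤ Cψ1 / T s * Ds s := by
  refine (ShearStage.norm_drift_le _ _ (abs_stQ_le s) _ _).trans ?_
  exact mul_le_mul_of_nonneg_right (abs_deriv_amp_le s t) (Ds_pos s).le

/-- For `s ≥ 2` the stage drifts are bounded by `1/2` (`F_{s-1} ≥ Cψ1/T_s`). [folklore] -/
theorem norm_stageDrift_le_half {s : ℕ} (hs : 2 ≤ s) (t : ℝ) (x : 𝕋²) : ‖stageDrift s t x‖ ≤ 2⁻¹ := by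
  refine (norm_stageDrift_le s t x).trans ?_
  obtain ⟨n, rfl⟩ := Nat.exists_eq_add_of_le' (by omega : 1 ≤ s)
  have hF := Cψ1_div_T_le_Fq (by omega : 1 ≤ n)
  rw [Ds_eq, Nat.add_sub_cancel]
  have hFpos := Fq_pos n
  have hT := T_pos (n + 1)
  have hC := Cψ1_spec.1
  rw [div_mul_div_comm, div_le_iff₀ (by positivity)]
  have h1 : Cψ1 ≤ Fq n * T (n + 1) := by rwa [div_le_iff₀ hT] at hF
  nlinarith

/-- **The energy bound of the cascade drifts.** [folklore] -/
def Bvel : ℝ := (Cψ1 / T 1 * Ds 1) ^ 2 + 1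

/-- `0 ≤ Bvel`. [folklore] -/
theorem Bvel_nonneg : 0 ≤ Bvel := by unfold Bvel; positivity

/-- **`∫ ‖vel m t‖² ≤ Bvel`** uniformly in `m` and `t`. [folklore] -/
theorem integral_norm_sq_vel_le (m : ℕ) (t : ℝ) : ∫ x, ‖vel m t x‖ ^ 2 ≤ Bvel := by
  have hpt : ∀ x, ‖vel m t x‖ ^ 2 ≤ Bvel := by
    intro x
    rw [vel_eq]
    split_ifs with h
    · have h1 : 1 ≤ act t := (Finset.mem_Icc.1 h).1
      rcases eq_or_lt_of_le h1 with he | hlt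
      · rw [← he]
        have := norm_stageDrift_le 1 t x
        have h0 := norm_nonneg (stageDrift 1 t x)
        unfold Bvel
        nlinarith [pow_le_pow_left₀ h0 this 2]
      · have := norm_stageDrift_le_half (by omega : 2 ≤ act t) t x
        have h0 := norm_nonneg (stageDrift (act t) t x)
        unfold Bvel
        have hsq : ‖stageDrift (act t) t x‖ ^ 2 ≤ 1 := by nlinarith
        have : (0 : ℝ) ≤ (Cψ1 / T 1 * Ds 1) ^ 2 := by positivity
        linarith
    · simp [Bvel_nonneg]
  calc ∫ x, ‖vel m t x‖ ^ 2 ≤ ∫ _ : 𝕋², Bvel :=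
        integral_mono (integrable_norm_sq_of_continuous (isSmooth_vel m t).continuous) (integrable_const _) hpt
    _ = Bvel := by simp

/-! ## Derivatives of the drift along the coordinate axes; the Laplacian of the drift -/

/-- The derivative profile `φ'`. [folklore] -/
def derivProfile (Q : ShearProfile) : ShearProfile where
  toFun := deriv Q
  periodic' := periodic_deriv Q.periodic
  contDiff' := (contDiff_infty_iff_deriv.mp Q.contDiff).2

/-- Values of the derivative profile. [folklore] -/
@[simp]
theorem derivProfile_apply (Q : ShearProfile) (t : ℝ) : derivProfile Q t = deriv Q t := rfl

/-- The derivative profile as a function. [folklore] -/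
theorem coe_derivProfile (Q : ShearProfile) : ((derivProfile Q : ShearProfile) : ℝ → ℝ) = deriv Q := rfl

/-- Translating a point of the torus along the axis `l` by `τ`. [folklore] -/
theorem add_proj_smul_single_apply (x : 𝕋²) (τ : ℝ) (l l' : Fin 2) :
    (x + proj (τ • EuclideanSpace.single l (1 : ℝ))) l' = x l' + ((if l' = l then τ else 0 : ℝ) : UnitAddCircle) := by
  rw [Pi.add_apply, proj_apply]
  congr 2
  simp [PiLp.single_apply]

/-- **The partial derivative of the drift along the driving axis**: `∂ⱼ((bφ(x_j))eᵢ) = (bφ'(x_j))eᵢ`. [folklore] -/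
theorem partialDeriv_drift_same (i j : Fin 2) (Q : ShearProfile) (b : ℝ) (x : 𝕋²) :
    FunctionSpaces.Torus.partialDeriv j (ShearStage.drift i j Q b) x = ShearStage.drift i j (derivProfile Q) b x := by
  unfold FunctionSpaces.Torus.partialDeriv FunctionSpaces.Torus.lineDeriv
  induction hξ : x j using QuotientAddGroup.induction_on with
  | H ξ =>
    have hfun : (fun τ : ℝ => ShearStage.drift i j Q b (x + proj (τ • EuclideanSpace.single j (1 : ℝ)))) =
        fun τ => (b * Q (ξ + τ)) • EuclideanSpace.single i (1 : ℝ) := by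
      funext τ
      rw [ShearStage.drift_apply, add_proj_smul_single_apply, if_pos rfl, hξ, ← AddCircle.coe_add,
        ShearProfile.onCircle_coe]
    rw [hfun]
    have hd : HasDerivAt (fun τ : ℝ => (b * Q (ξ + τ)) • EuclideanSpace.single i (1 : ℝ))
        ((b * deriv Q ξ) • EuclideanSpace.single i (1 : ℝ)) 0 := by
      have h1 : HasDerivAt (fun τ : ℝ => Q (ξ + τ)) (deriv Q ξ) 0 := by
        have h0 : HasDerivAt (fun τ : ℝ => ξ + τ) 1 0 := by simpa using (hasDerivAt_id (0 : ℝ)).const_add ξ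
        have hQ : HasDerivAt Q (deriv Q (ξ + 0)) (ξ + 0) := ((Q.contDiff.differentiable (by simp)).differentiableAt).hasDerivAt
        have := hQ.comp 0 h0
        simpa [Function.comp_def] using this
      exact (h1.const_mul b).smul_const _
    rw [hd.deriv, ShearStage.drift_apply, hξ, ShearProfile.onCircle_coe, derivProfile_apply]

/-- **The partial derivative of the drift along the other axis vanishes.** [folklore] -/
theorem partialDeriv_drift_of_ne {i j l : Fin 2} (hl : l ≠ j) (Q : ShearProfile) (b : ℝ) (x : 𝕋²) :
    FunctionSpaces.Torus.partialDeriv l (ShearStage.drift i j Q b) x = 0 := by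
  unfold FunctionSpaces.Torus.partialDeriv FunctionSpaces.Torus.lineDeriv
  have hfun : (fun τ : ℝ => ShearStage.drift i j Q b (x + proj (τ • EuclideanSpace.single l (1 : ℝ)))) =
      fun _ => ShearStage.drift i j Q b x := by
    funext τ
    rw [ShearStage.drift_apply, ShearStage.drift_apply, add_proj_smul_single_apply, if_neg hl.symm]
    simp
  rw [hfun, deriv_const]

/-- **The Laplacian of the drift**: `Δ((bφ(x_j))eᵢ) = (bφ''(x_j))eᵢ`. [folklore] -/
theorem laplacian_drift (i j : Fin 2) (Q : ShearProfile) (b : ℝ) (x : 𝕋²) :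
    FunctionSpaces.Torus.laplacian (ShearStage.drift i j Q b) x = ShearStage.drift i j (derivProfile (derivProfile Q)) b x := by
  rw [laplacian_eq_sum_partialDeriv_partialDeriv (ShearStage.isSmooth_drift i j Q b)]
  have hj : FunctionSpaces.Torus.partialDeriv j (ShearStage.drift i j Q b) = ShearStage.drift i j (derivProfile Q) b :=
    funext (partialDeriv_drift_same i j Q b)
  have hzero : ∀ l : Fin 2, FunctionSpaces.Torus.partialDeriv l (fun _ : 𝕋² => (0 : E²)) x = 0 := fun l => by
    simp [FunctionSpaces.Torus.partialDeriv, FunctionSpaces.Torus.lineDeriv]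
  rw [Finset.sum_eq_single j]
  · rw [hj, partialDeriv_drift_same]
  · intro l _ hl
    have hl' : FunctionSpaces.Torus.partialDeriv l (ShearStage.drift i j Q b) = fun _ => 0 :=
      funext (partialDeriv_drift_of_ne hl Q b)
    rw [hl', hzero]
  · simp

/-- **Bound of the Laplacian of the drift**: `‖Δ drift‖ ≤ |b| sup|φ''|`. [folklore] -/
theorem norm_laplacian_drift_le (i j : Fin 2) {Q : ShearProfile} {M : ℝ} (hM : ∀ t, |deriv (deriv Q) t| ≤ M)
    (b : ℝ) (x : 𝕋²) : ‖FunctionSpaces.Torus.laplacian (ShearStage.drift i j Q b) x‖ ≤ |b| * M := by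
  rw [laplacian_drift i j]
  exact ShearStage.norm_drift_le i j (P := derivProfile (derivProfile Q))
    (fun t => by rw [derivProfile_apply, coe_derivProfile]; exact hM t) b x

/-! ## The Navier–Stokes forces of the cascade drifts and their limit -/

/-- The force of stage `s` (its Euler force, pressure zero): `ä_s(t) Q_s(x_j) eᵢ`. [folklore] -/
def stageForce (s : ℕ) (t : ℝ) : 𝕋² → E² := ShearStage.drift (dir s) (dir (s + 1)) (stQ s) (deriv (deriv (amp s)) t)

/-- The force of an inactive stage vanishes. [folklore] -/
theorem stageForce_eq_zero_of_ne_act {s : ℕ} {t : ℝ} (h : s ≠ act t) : stageForce s t = 0 := by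
  rw [stageForce, deriv_deriv_amp_eq_zero_of_ne_act h, ShearStage.drift_zero]

/-- The accumulated Euler force of the `m`-truncated cascade. [folklore] -/
def accForce (m : ℕ) (t : ℝ) (x : 𝕋²) : E² := ∑ s ∈ Finset.Icc 1 m, stageForce s t x

/-- At most one stage contributes to the accumulated force. [folklore] -/
theorem accForce_eq (m : ℕ) (t : ℝ) : accForce m t = if act t ∈ Finset.Icc 1 m then stageForce (act t) t else 0 := by
  funext x
  rw [accForce]
  split_ifs with h
  · rw [Finset.sum_eq_single_of_mem (act t) h]
    intro s _ hs
    rw [stageForce_eq_zero_of_ne_act hs]; rfl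
  · rw [Finset.sum_eq_zero]
    · rfl
    · intro s hs
      rw [stageForce_eq_zero_of_ne_act (fun h' => h (h' ▸ hs))]; rfl

/-- **The limit force** `g(t) = ä_s(t) Q_s(x_j) eᵢ` with `s` the active stage (all stages), `0`
when no stage `≥ 1` moves. [folklore] -/
def gLim (t : ℝ) : 𝕋² → E² := accForce (act t) t

/-- The limit force is the force of the active stage (or zero). [folklore] -/
theorem gLim_eq (t : ℝ) : gLim t = if 1 ≤ act t then stageForce (act t) t else 0 := by
  rw [gLim, accForce_eq]
  by_cases h : 1 ≤ act t
  · rw [if_pos (Finset.mem_Icc.2 ⟨h, le_rfl⟩), if_pos h]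
  · rw [if_neg (fun hm => h (Finset.mem_Icc.1 hm).1), if_neg h]

/-- `accForce m t = gLim t` as soon as `act t ≤ m`. [folklore] -/
theorem accForce_eq_gLim {m : ℕ} {t : ℝ} (h : act t ≤ m) : accForce m t = gLim t := by
  rw [accForce_eq, gLim_eq]
  by_cases h1 : 1 ≤ act t
  · rw [if_pos (Finset.mem_Icc.2 ⟨h1, h⟩), if_pos h1]
  · rw [if_neg (fun hm => h1 (Finset.mem_Icc.1 hm).1), if_neg h1]

/-- **The time derivative of the cascade drift is the accumulated force.** [folklore] -/
theorem timeDerivWithin_vel (m : ℕ) (t : ℝ) (x : 𝕋²) :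
    FunctionSpaces.Torus.timeDerivWithin univ (vel m) t x = accForce m t x := by
  rw [FunctionSpaces.Torus.timeDerivWithin, derivWithin_univ]
  have h : ∀ s, HasDerivAt (fun τ => stageDrift s τ x) (stageForce s t x) t := by
    intro s
    simp only [stageDrift, stageForce, ShearStage.drift_apply]
    have h1 : HasDerivAt (deriv (amp s)) (deriv (deriv (amp s)) t) t :=
      ((contDiff_infty_iff_deriv.mp (contDiff_amp s)).2.differentiable (by simp)).differentiableAt.hasDerivAt
    exact (h1.mul_const _).smul_const _
  have hsum := HasDerivAt.fun_sum (u := Finset.Icc 1 m) (fun s _ => h s)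
  simp only [vel, accForce] at hsum ⊢
  exact hsum.deriv

/-- `(V·∇)W = 0` when `V = 0`. [folklore] -/
theorem convect_zero_left' (w : 𝕋² → E²) (x : 𝕋²) : FunctionSpaces.Torus.convect (0 : 𝕋² → E²) w x = 0 := by
  simp [FunctionSpaces.Torus.convect]

/-- **The cascade drift has no nonlinear term**: `(vel·∇)vel = 0`. [folklore] -/
theorem convect_vel (m : ℕ) (t : ℝ) (x : 𝕋²) : FunctionSpaces.Torus.convect (vel m t) (vel m t) x = 0 := by
  rw [vel_eq]
  split_ifs
  · exact ShearStage.convect_drift_self (dir_succ_ne (act t)).symm _ _ _ _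
  · exact convect_zero_left' _ x

/-- The Laplacian of the zero field vanishes. [folklore] -/
theorem laplacian_zero' (x : 𝕋²) : FunctionSpaces.Torus.laplacian (0 : 𝕋² → E²) x = 0 :=
  Torus.laplacian_zero x

/-- **The Navier–Stokes force of the cascade drift**:
`g^m(t) = accForce m (t) - ν Δ(vel m (t))`. [folklore] -/
theorem nsBodyForce_vel (νc : ℝ) (m : ℕ) (t : ℝ) (x : 𝕋²) :
    Torus.nsBodyForce νc (vel m) t x = accForce m t x - νc • FunctionSpaces.Torus.laplacian (vel m t) x := by
  rw [Torus.nsBodyForce_apply, timeDerivWithin_vel, convect_vel, add_zero]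

/-! ## The force bounds -/

/-- The second derivative of a scaled profile. [folklore] -/
theorem deriv_deriv_scale (S : ShearProfile) (D : ℝ) (F : ℕ) (t : ℝ) :
    deriv (deriv (S.scale D F)) t = D * F ^ 2 * deriv (deriv S) (F * t) := by
  have h1 : ∀ t, deriv (S.scale D F) t = D * F * deriv S (F * t) := by
    intro t
    have hS : HasDerivAt S (deriv S (F * t)) (F * t) := ((S.contDiff.differentiable (by simp)).differentiableAt).hasDerivAt
    have h : HasDerivAt (fun t => D * S (F * t)) (D * (deriv S (F * t) * F)) t :=
      (hS.comp t ((hasDerivAt_id t).const_mul (F : ℝ) |>.congr_deriv (by simp))).const_mul D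
    have hfun : (S.scale D F : ℝ → ℝ) = fun t => D * S (F * t) := funext fun t => S.scale_apply D F t
    rw [hfun, h.deriv]; ring
  have hfun : deriv (S.scale D F) = fun t => D * F * deriv S (F * t) := funext h1
  rw [hfun]
  have hS : HasDerivAt (deriv S) (deriv (deriv S) (F * t)) (F * t) :=
    (((contDiff_infty_iff_deriv.mp S.contDiff).2.differentiable (by simp)).differentiableAt).hasDerivAt
  have h : HasDerivAt (fun t => D * F * deriv S (F * t)) (D * F * (deriv (deriv S) (F * t) * F)) t :=
    (hS.comp t ((hasDerivAt_id t).const_mul (F : ℝ) |>.congr_deriv (by simp))).const_mul (D * F)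
  rw [h.deriv]; ring

/-- **Bound of the second derivative of the stage profile**: `|Q_s''| ≤ D_s F_s² L2_s`. [folklore] -/
theorem abs_deriv_deriv_stQ_le (s : ℕ) (t : ℝ) : |deriv (deriv (stQ s)) t| ≤ Ds s * Fq s ^ 2 * L2 s := by
  unfold stQ ProfileFamily.stP ProfileFamily.stageProfile
  rw [deriv_deriv_scale, abs_mul, abs_mul, abs_of_nonneg (by positivity : (0 : ℝ) ≤ (cascadePF.F extra s : ℝ) ^ 2)]
  have hD : |disp (cascadePF.F extra) s| = Ds s := abs_of_pos (Ds_pos s)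
  rw [hD]
  exact mul_le_mul_of_nonneg_left ((L2_spec s).2 _) (by have := Ds_pos s; positivity)

/-- **The viscous term of the active stage `s ≤ m`**:
`ν_m ‖Δ(stageDrift s (t))‖ ≤ μ_m Cψ1 F_s² L2_s / (F_m² T_s 2F_{s-1})`. [folklore] -/
theorem norm_visc_stageDrift_le (m s : ℕ) (t : ℝ) (x : 𝕋²) :
    ν m * ‖FunctionSpaces.Torus.laplacian (stageDrift s t) x‖ ≤ μ m / Fq m ^ 2 * (Cψ1 / T s * (Ds s * Fq s ^ 2 * L2 s)) := by
  unfold ν stageDrift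
  refine mul_le_mul_of_nonneg_left ?_ (by have := μ_nonneg m; positivity)
  refine (norm_laplacian_drift_le _ _ (abs_deriv_deriv_stQ_le s) _ _).trans ?_
  exact mul_le_mul_of_nonneg_right (abs_deriv_amp_le s t) (by have := Ds_pos s; have := (L2_spec s).1; positivity)

/-- **Own stage**: for `m ≥ 2`, `ν_m ‖Δ(stageDrift m (t))‖ ≤ 2^{-(m+1)}`. [folklore] -/
theorem norm_visc_own_le {m : ℕ} (hm : 2 ≤ m) (t : ℝ) (x : 𝕋²) :
    ν m * ‖FunctionSpaces.Torus.laplacian (stageDrift m t) x‖ ≤ 1 / 2 ^ (m + 1) := by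
  refine (norm_visc_stageDrift_le m m t x).trans ?_
  obtain ⟨n, rfl⟩ := Nat.exists_eq_add_of_le' (by omega : 1 ≤ m)
  have hF := visc_scale_le_Fq (by omega : 1 ≤ n)   -- 2^{n+1} μ_{n+1} Cψ1 L2_{n+1} / T_{n+1} ≤ F_n
  have hFn := Fq_pos n
  have hFm := Fq_pos (n + 1)
  have hT := T_pos (n + 1)
  have hC := Cψ1_spec.1
  have hL := (L2_spec (n + 1)).1
  have hμ := μ_nonneg (n + 1)
  rw [Ds_eq, Nat.add_sub_cancel]
  -- the left side equals `μ Cψ1 L2 / (2 T F_n)`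
  have e : μ (n + 1) / Fq (n + 1) ^ 2 * (Cψ1 / T (n + 1) * (1 / (2 * Fq n) * Fq (n + 1) ^ 2 * L2 (n + 1))) =
      (2 ^ (n + 1) * μ (n + 1) * Cψ1 * L2 (n + 1) / T (n + 1)) / (2 ^ (n + 2) * Fq n) := by
    field_simp; ring
  rw [e, div_le_div_iff₀ (by positivity) (by positivity), one_mul]
  calc 2 ^ (n + 1) * μ (n + 1) * Cψ1 * L2 (n + 1) / T (n + 1) * 2 ^ (n + 1 + 1)
      ≤ Fq n * 2 ^ (n + 1 + 1) := by gcongr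
    _ = 2 ^ (n + 2) * Fq n := by ring

/-- **Earlier stages**: for `1 ≤ s < m`, `ν_m ‖Δ(stageDrift s (t))‖ ≤ 2^{-m}`. [folklore] -/
theorem norm_visc_earlier_le {m s : ℕ} (hs : 1 ≤ s) (hsm : s < m) (t : ℝ) (x : 𝕋²) :
    ν m * ‖FunctionSpaces.Torus.laplacian (stageDrift s t) x‖ ≤ 1 / 2 ^ m := by
  refine (norm_visc_stageDrift_le m s t x).trans ?_
  have hm : 1 ≤ m := by omega
  have hF := visc_sum_scale_le_Fq hm     -- F_{m-1} 2^m μ_m (1 + Σ κ) ≤ F_m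
  have hκmem : κ s ≤ 1 + ∑ r ∈ Finset.range m, κ r := by
    have : κ s ≤ ∑ r ∈ Finset.range m, κ r :=
      Finset.single_le_sum (fun r _ => κ_nonneg r) (Finset.mem_range.2 hsm)
    linarith
  have hFs : (Fq s : ℝ) ≤ Fq (m - 1) := by exact_mod_cast cascadePF.F_mono extra (by omega : s ≤ m - 1)
  have hFs1 : (1 : ℝ) ≤ Fq (s - 1) := one_le_Fq _
  have hFm1 := Fq_pos (m - 1)
  have hFm := Fq_pos m
  have hT := T_pos s
  have hC := Cψ1_spec.1
  have hL := (L2_spec s).1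
  have hμ := μ_nonneg m
  have hD := Ds_pos s
  -- `μ/F_m² · Cψ1/T_s · D_s F_s² L2_s = μ (F_s/F_m)² κ_s / F_{s-1}` with `κ_s = Cψ1 L2_s/(2T_s)`
  have e : μ m / (Fq m : ℝ) ^ 2 * (Cψ1 / T s * (Ds s * (Fq s : ℝ) ^ 2 * L2 s)) = μ m * ((Fq s : ℝ) / Fq m) ^ 2 * κ s / Fq (s - 1) := by
    rw [Ds_eq]; unfold κ; field_simp
  rw [e]
  have h1 : μ m * ((Fq s : ℝ) / Fq m) ^ 2 * κ s / Fq (s - 1) ≤ μ m * ((Fq s : ℝ) / Fq m) ^ 2 * κ s := by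
    refine div_le_self (by have := κ_nonneg s; positivity) hFs1
  refine h1.trans ?_
  have hratio : ((Fq s : ℝ) / Fq m) ^ 2 ≤ (Fq (m - 1) : ℝ) / Fq m := by
    have hle : (Fq s : ℝ) / Fq m ≤ (Fq (m - 1) : ℝ) / Fq m := div_le_div_of_nonneg_right hFs hFm.le
    have hle1 : (Fq (m - 1) : ℝ) / Fq m ≤ 1 := by
      rw [div_le_one hFm]; exact_mod_cast cascadePF.F_mono extra (Nat.sub_le m 1)
    have h0 : (0 : ℝ) ≤ (Fq s : ℝ) / Fq m := by positivity
    calc ((Fq s : ℝ) / Fq m) ^ 2 ≤ ((Fq (m - 1) : ℝ) / Fq m) ^ 2 := pow_le_pow_left₀ h0 hle 2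
      _ ≤ (Fq (m - 1) : ℝ) / Fq m := by
          rw [sq]; exact mul_le_of_le_one_left (by positivity) hle1
  have hκ := κ_nonneg s
  calc μ m * ((Fq s : ℝ) / Fq m) ^ 2 * κ s ≤ μ m * ((Fq (m - 1) : ℝ) / Fq m) * κ s := by gcongr
    _ ≤ μ m * ((Fq (m - 1) : ℝ) / Fq m) * (1 + ∑ r ∈ Finset.range m, κ r) := by gcongr
    _ = (Fq (m - 1) : ℝ) * (2 ^ m * μ m * (1 + ∑ r ∈ Finset.range m, κ r)) / (2 ^ m * (Fq m : ℝ)) := by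
        field_simp
    _ ≤ (Fq m : ℝ) / (2 ^ m * (Fq m : ℝ)) := div_le_div_of_nonneg_right hF (by positivity)
    _ = 1 / 2 ^ m := by field_simp

/-- **The viscous term of the cascade drift**: `ν_m ‖Δ(vel m (t))‖ ≤ 2^{-m}` for `m ≥ 2`. [folklore] -/
theorem norm_visc_vel_le {m : ℕ} (hm : 2 ≤ m) (t : ℝ) (x : 𝕋²) :
    ν m * ‖FunctionSpaces.Torus.laplacian (vel m t) x‖ ≤ 1 / 2 ^ m := by
  rw [vel_eq]
  split_ifs with h
  · obtain ⟨h1, h2⟩ := Finset.mem_Icc.1 h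
    rcases eq_or_lt_of_le h2 with he | hlt
    · rw [he]
      refine (norm_visc_own_le hm t x).trans ?_
      gcongr
      · norm_num
      · omega
    · exact norm_visc_earlier_le h1 hlt t x
  · rw [laplacian_zero', norm_zero, mul_zero]; positivity

/-- **The late stages' forces are small**: `‖stageForce s t x‖ ≤ 2^{-(s+1)}` for `s ≥ 2`. [folklore] -/
theorem norm_stageForce_le {s : ℕ} (hs : 2 ≤ s) (t : ℝ) (x : 𝕋²) : ‖stageForce s t x‖ ≤ 1 / 2 ^ (s + 1) := by
  unfold stageForce
  refine (ShearStage.norm_drift_le _ _ (abs_stQ_le s) _ _).trans ?_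
  refine (mul_le_mul_of_nonneg_right (abs_deriv_deriv_amp_le s t) (Ds_pos s).le).trans ?_
  obtain ⟨n, rfl⟩ := Nat.exists_eq_add_of_le' (by omega : 1 ≤ s)
  have hF := force_scale_le_Fq (by omega : 1 ≤ n)     -- 2^{n+1} Cψ2 / T_{n+1}² ≤ F_n
  rw [Ds_eq, Nat.add_sub_cancel]
  have hFn := Fq_pos n
  have hT := T_pos (n + 1)
  have hC := Cψ2_spec.1
  rw [div_mul_div_comm, div_le_div_iff₀ (by positivity) (by positivity), one_mul]
  calc Cψ2 * 1 * 2 ^ (n + 1 + 1) = 2 ^ (n + 1) * Cψ2 / T (n + 1) ^ 2 * (T (n + 1) ^ 2 * 2) := by field_simp; ring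
    _ ≤ Fq n * (T (n + 1) ^ 2 * 2) := by gcongr
    _ = T (n + 1) ^ 2 * (2 * Fq n) := by ring

/-- **The force difference, pointwise**: for `m ≥ 2`,
`‖g^m(t, x) - g(t, x)‖ ≤ 2^{-(m+1)} + 2^{-m}` — the inviscid parts differ only when a stage
`> m` moves (force `≤ 2^{-(m+2)}`), and the viscous part is `≤ 2^{-m}`. [folklore] -/
theorem norm_nsBodyForce_sub_gLim_le {m : ℕ} (hm : 2 ≤ m) (t : ℝ) (x : 𝕋²) :
    ‖Torus.nsBodyForce (ν m) (vel m) t x - gLim t x‖ ≤ 1 / 2 ^ (m + 1) + 1 / 2 ^ m := by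
  rw [nsBodyForce_vel]
  have hvisc := norm_visc_vel_le hm t x
  have hν : 0 ≤ ν m := by unfold ν; have := μ_nonneg m; positivity
  have hinv : ‖accForce m t x - gLim t x‖ ≤ 1 / 2 ^ (m + 1) := by
    by_cases h : act t ≤ m
    · rw [accForce_eq_gLim h, sub_self, norm_zero]; positivity
    · push Not at h
      have h0 : accForce m t x = 0 := by
        rw [accForce_eq, if_neg (fun hm' => absurd (Finset.mem_Icc.1 hm').2 (by omega))]; rfl
      rw [h0, zero_sub, norm_neg, gLim_eq, if_pos (by omega)]
      refine (norm_stageForce_le (by omega) t x).trans ?_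
      gcongr; norm_num
  calc ‖accForce m t x - ν m • FunctionSpaces.Torus.laplacian (vel m t) x - gLim t x‖
      = ‖(accForce m t x - gLim t x) - ν m • FunctionSpaces.Torus.laplacian (vel m t) x‖ := by abel_nf
    _ ≤ ‖accForce m t x - gLim t x‖ + ‖ν m • FunctionSpaces.Torus.laplacian (vel m t) x‖ := norm_sub_le _ _
    _ ≤ 1 / 2 ^ (m + 1) + 1 / 2 ^ m := by
        rw [norm_smul, Real.norm_eq_abs, abs_of_nonneg hν]
        exact add_le_add hinv hvisc

/-! ## The limit force: smoothness, continuity in `L²`, convergence -/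

/-- If the active stage index is positive, the time lies in that stage's open slot. [folklore] -/
theorem mem_slot_act {t : ℝ} (h : act t ≠ 0) : t ∈ Ioo (σ (act t)) (σ (act t) + T (act t)) := by
  classical
  by_cases hex : ∃ s, t ∈ Ioo (σ s) (σ s + T s)
  · have : act t = Nat.find hex := by rw [act, dif_pos hex]
    rw [this]; exact Nat.find_spec hex
  · exact absurd (by rw [act, dif_neg hex]) h

/-- Before `σ_{N+1}` only the stages `≤ N` can be active. [folklore] -/
theorem act_le_of_lt {N : ℕ} {t : ℝ} (ht : t < σ (N + 1)) : act t ≤ N := by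
  by_contra h
  push Not at h
  have hslot := mem_slot_act (by omega : act t ≠ 0)
  have hσ : σ (N + 1) ≤ σ (act t) := σ_strictMono.monotone (by omega)
  linarith [hslot.1]

/-- After `σ_N`, an active stage has index at least `N`. [folklore] -/
theorem le_act_of_lt {N : ℕ} {t : ℝ} (ht : σ N < t) (h : act t ≠ 0) : N ≤ act t := by
  by_contra hlt
  push Not at hlt
  have hslot := mem_slot_act h
  have h1 := σ_add_T_lt (act t)
  have h2 : σ (act t + 1) ≤ σ N := σ_strictMono.monotone (by omega)
  linarith [hslot.2]

/-- The stage forces are smooth in space–time. [folklore] -/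
theorem isSmoothSpaceTimeOn_stageForce (s : ℕ) : FunctionSpaces.Torus.IsSmoothSpaceTimeOn univ (stageForce s) :=
  ShearStage.isSmoothSpaceTimeOn_drift _ _ _
    (contDiff_infty_iff_deriv.mp (contDiff_infty_iff_deriv.mp (contDiff_amp s)).2).2 univ

/-- The accumulated forces are smooth in space–time. [folklore] -/
theorem isSmoothSpaceTimeOn_accForce (m : ℕ) : FunctionSpaces.Torus.IsSmoothSpaceTimeOn univ (accForce m) :=
  FunctionSpaces.Torus.IsSmoothSpaceTimeOn.sum fun s _ => isSmoothSpaceTimeOn_stageForce s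

/-- **The limit force has smooth slices.** [folklore] -/
theorem isSmooth_gLim (t : ℝ) : IsSmooth (gLim t) := (isSmoothSpaceTimeOn_accForce (act t)).isSmooth_slice (mem_univ t)

/-- **Locally before the blow-up time the limit force is an accumulated force**:
`gLim = accForce N` on `(-∞, σ_{N+1})`. [folklore] -/
theorem gLim_eq_accForce_of_lt {N : ℕ} {t : ℝ} (ht : t < σ (N + 1)) : gLim t = accForce N t :=
  (accForce_eq_gLim (act_le_of_lt ht)).symm

/-- **The limit force decays at the blow-up time**: for `N ≥ 2` and `t > σ_N`,
`‖gLim t x‖ ≤ 2^{-(N+1)}`. [folklore] -/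
theorem norm_gLim_le_of_lt {N : ℕ} (hN : 2 ≤ N) {t : ℝ} (ht : σ N < t) (x : 𝕋²) : ‖gLim t x‖ ≤ 1 / 2 ^ (N + 1) := by
  rw [gLim_eq]
  split_ifs with h
  · have hN' := le_act_of_lt ht (by omega)
    refine (norm_stageForce_le (hN.trans hN') t x).trans ?_
    gcongr; norm_num
  · simp only [Pi.zero_apply, norm_zero]; positivity

/-- The limit force vanishes from the blow-up time on. [folklore] -/
theorem gLim_eq_zero_of_one_le {t : ℝ} (ht : 1 ≤ t) : gLim t = 0 := by
  rw [gLim_eq, if_neg]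
  intro h
  have hslot := mem_slot_act (by omega : act t ≠ 0)
  have := mem_Ioo_of_deriv_amp_ne_zero h (t := t) ?_
  · linarith [this.2]
  · -- inside the open slot the amplitude really moves? Not needed: use the slot geometry directly.
    exact fun _ => by
      have h1 := σ_add_T_lt (act t)
      have h2 := σ_lt_one (act t + 1)
      linarith [hslot.2]

/-- **The limit force is in `C(ℝ; L²)`.** [folklore] -/
theorem continuousInLpOn_gLim : Torus.ContinuousInLpOn univ 2 gLim := by
  refine ⟨fun t _ => (isSmooth_gLim t).memLp 2, fun t₀ _ => ?_⟩
  rw [nhdsWithin_univ]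
  by_cases ht₀ : t₀ < 1
  · -- locally an accumulated force
    obtain ⟨N, hN⟩ := ((tendsto_σ.eventually (Ioi_mem_nhds ht₀))).exists
    have hN' : t₀ < σ (N + 1) := lt_trans (mem_Ioi.1 hN) (σ_strictMono (Nat.lt_succ_self N))
    have hc := (isSmoothSpaceTimeOn_accForce N).continuousInLpOn 2
    have h := hc.2 t₀ (mem_univ t₀)
    rw [nhdsWithin_univ] at h
    refine h.congr' ?_
    filter_upwards [Iio_mem_nhds hN'] with t ht
    rw [gLim_eq_accForce_of_lt (mem_Iio.1 ht), gLim_eq_accForce_of_lt hN']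
  · -- at and after the blow-up time
    push Not at ht₀
    rw [gLim_eq_zero_of_one_le ht₀]
    simp only [sub_zero]
    rw [ENNReal.tendsto_nhds_zero]
    intro ε hε
    -- choose `N ≥ 2` with `2^{-(N+1)} < ε`
    obtain ⟨N, hN2, hNε⟩ : ∃ N : ℕ, 2 ≤ N ∧ ENNReal.ofReal (1 / 2 ^ (N + 1)) < ε := by
      have h : Tendsto (fun N : ℕ => ENNReal.ofReal (1 / 2 ^ (N + 1))) atTop (𝓝 (ENNReal.ofReal 0)) := by
        refine (ENNReal.continuous_ofReal.tendsto 0).comp ?_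
        have : Tendsto (fun N : ℕ => (1 / 2 : ℝ) ^ N * (1 / 2)) atTop (𝓝 (0 * (1 / 2))) :=
          (tendsto_pow_atTop_nhds_zero_of_lt_one (by norm_num) (by norm_num)).mul_const _
        rw [zero_mul] at this
        refine this.congr fun N => ?_
        rw [pow_succ, one_div, inv_pow]; field_simp
      rw [ENNReal.ofReal_zero] at h
      obtain ⟨N, hN⟩ := ((h.eventually (gt_mem_nhds hε)).and (eventually_ge_atTop 2)).exists
      exact ⟨N, hN.2, hN.1⟩
    filter_upwards [Ioi_mem_nhds (lt_of_lt_of_le (σ_lt_one N) ht₀)] with t ht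
    refine (Torus.eLpNorm_le_of_forall_norm_le (norm_gLim_le_of_lt hN2 (mem_Ioi.1 ht)) 2).trans hNε.le

/-- **Convergence of the forces**: `sup_t ‖g^m(t) - g(t)‖_{L²} → 0`. [folklore] -/
theorem tendsto_iSup_eLpNorm_nsBodyForce_sub_gLim :
    Tendsto (fun m => ⨆ t : ℝ, eLpNorm (Torus.nsBodyForce (ν m) (vel m) t - gLim t) 2 volume) atTop (𝓝 0) := by
  have hb : Tendsto (fun m : ℕ => ENNReal.ofReal (1 / 2 ^ (m + 1) + 1 / 2 ^ m)) atTop (𝓝 (ENNReal.ofReal 0)) := by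
    refine (ENNReal.continuous_ofReal.tendsto 0).comp ?_
    have h1 : Tendsto (fun m : ℕ => (1 / 2 : ℝ) ^ m) atTop (𝓝 0) := tendsto_pow_atTop_nhds_zero_of_lt_one (by norm_num) (by norm_num)
    have h2 : Tendsto (fun m : ℕ => (1 / 2 : ℝ) ^ m * (1 / 2)) atTop (𝓝 (0 * (1 / 2))) := h1.mul_const _
    rw [zero_mul] at h2
    have := h2.add h1
    rw [add_zero] at this
    refine this.congr fun m => ?_
    rw [one_div, inv_pow, pow_succ]; field_simp
  rw [ENNReal.ofReal_zero] at hb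
  refine tendsto_of_tendsto_of_tendsto_of_le_of_le' tendsto_const_nhds hb (Eventually.of_forall fun m => zero_le) ?_
  filter_upwards [eventually_ge_atTop 2] with m hm
  refine iSup_le fun t => ?_
  exact Torus.eLpNorm_le_of_forall_norm_le (fun x => by simpa only [Pi.sub_apply] using norm_nsBodyForce_sub_gLim_le hm t x) 2

/-! ## The viscosities are positive and tend to zero -/

/-- `0 < ν_m`. [folklore] -/
theorem ν_pos (m : ℕ) : 0 < ν m := by unfold ν; have := μ_pos m; have := Fq_pos m; positivity

/-- `ν_m ≤ 64 / 16^m` (`F_m ≥ 8^m`, `m + 1 ≤ 2^m`). [folklore] -/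
theorem ν_le (m : ℕ) : ν m ≤ 64 / 16 ^ m := by
  unfold ν μ
  have hF : (8 : ℝ) ^ m ≤ Fq m := by exact_mod_cast cascadePF.pow_le_F extra m
  have hm : ((m : ℝ) + 1) ≤ 2 ^ m := by exact_mod_cast (Nat.lt_two_pow_self : m < 2 ^ m)
  have hF2 : (64 : ℝ) ^ m ≤ Fq m ^ 2 := by
    calc (64 : ℝ) ^ m = (8 ^ m) ^ 2 := by rw [← pow_mul, mul_comm, pow_mul]; norm_num
      _ ≤ Fq m ^ 2 := pow_le_pow_left₀ (by positivity) hF 2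
  have h64 : (0 : ℝ) < 64 ^ m := by positivity
  calc 64 * ((m : ℝ) + 1) * 2 ^ m / Fq m ^ 2 ≤ 64 * 2 ^ m * 2 ^ m / 64 ^ m := by
        rw [div_le_div_iff₀ (by have := Fq_pos m; positivity) h64]
        calc 64 * ((m : ℝ) + 1) * 2 ^ m * 64 ^ m ≤ 64 * 2 ^ m * 2 ^ m * 64 ^ m := by gcongr
          _ ≤ 64 * 2 ^ m * 2 ^ m * Fq m ^ 2 := by gcongr
    _ = 64 / 16 ^ m := by
        rw [show (64 : ℝ) ^ m = 16 ^ m * (2 ^ m * 2 ^ m) by rw [← mul_pow, ← mul_pow]; norm_num]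
        field_simp

/-- **`ν_m → 0`.** [folklore] -/
theorem tendsto_ν : Tendsto ν atTop (𝓝 0) := by
  have h : Tendsto (fun m : ℕ => (64 : ℝ) / 16 ^ m) atTop (𝓝 (64 * 0)) := by
    simp_rw [div_eq_mul_inv, ← inv_pow]
    exact (tendsto_pow_atTop_nhds_zero_of_lt_one (by norm_num) (by norm_num)).const_mul 64
  rw [mul_zero] at h
  exact squeeze_zero (fun m => (ν_pos m).le) ν_le h

end ShearCascade

end Literature.Analysis.FluidPDE
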